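import Literature.NumberTheory.GaloisRepresentations.KummerGalFixing
import Literature.NumberTheory.GaloisRepresentations.ArtinReciprocityCharacterFiniteProofs
import Literature.NumberTheory.Automorphic.GaloisActionPlaces
import HarnessLib

/-!
# Crux `PrintCf2.SplitBadTwoRankOneOfFacts` (stmt-BirchSwinnertonDyer-20368), skeleton v13.4, S3n′/(REG₂) FACT-FREE road, R2 programme,
# θ-BOOKKEEPING complement: THE NON-SPLIT VALUATION TRICK — at the places of `F′ = F·K_{θ₀}` NOT split over `F` the valuation hypothesis
# of R1 for the Kummer element of a SIGN-TWISTED dual class holds with NO local condition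

Cell `bsd-print-cf2`, EXTRA WIDTH seat `bsd-line-cf2-p1-w4` g14 (prover-bsd-line-cf2-p1-w4-g14-0); `--supports stmt-BirchSwinnertonDyer-20368`
(helper, Theses-free, Summits-import-free). HONEST FRAMING: nothing here closes the crux or a registered stub; BSD is not proved by any of
this; no summit statement is proved by this seat. No definition, no named fact, no `sorry`. UNCONDITIONAL; MODEL-FREE (functions
`Γ_K → K̄ˣ`, as in -w3 g13's `KummerU.twisted_proNull_of_untwisted` p703424 / `KummerUClassLevel` p703858).

WHY (memos `S3N-FACTFREE-w2g14.md` §§3, 7(c), 8–9, `R2-BRICKS-w5g7.md` §3 «θ-BOOKKEEPING», -w4 g13 STATUS 06:32:25Z note (N1)). The level lift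
for the sign-corrected quadratic character `θ₀` (R5, p700990) runs (PRO-NULL)_U for the TWISTED dual levels `μ_{2^M}(θ₀)`: an `ε`-twisted
cocycle `c : U → K̄ˣ` (`c(gh) = c(g)·(g•c(h))^{ε g}`), which on `U′ = Gal(K̄/F′)`, `F′ = F·K_{θ₀}`, is the Kummer cocycle of `β`, `βⁿ = b ∈ F′`;
R1 (p696581 `KummerProNull.exists_level_forall_exists_pow_eq_of_local`, over `F′`, abelian over `K`) then wants `2^M ∣ ord_{w″}(b)` at every
place `w″ ∤ v` of `F′`. At the places where the dual level module is UNRAMIFIED this comes from the dual-Selmer reading (B2d + B4b: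
`UnramifiedOrthogonal` needs `GaloisRep.IsUnramifiedAt`); at the places of `F′` above `S_{θ₀}` (where `μ(θ₀)` IS ramified, so
`UnramifiedOrthogonal` is unavailable) and at the places above `v̄` that do not split in `F′/F` NOTHING is delivered — and nothing is needed:
* §1 (N1) **`exists_algebraMap_pow_eq_mul_smul`** — for `s ∈ U` with `ε(s) = −1`: `δ := β · s(β) · c(s)` is `Gal(K̄/F′)`-fixed (the twisted
  cocycle identity at `(s, s⁻¹us)` and `(u, s)`), so `b · s(b) = dⁿ` with `d ∈ F′` («the class of `b` in `F′ˣ/F′ˣⁿ` is in the `ε`-part»);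
  **`exists_pow_eq_mul_absRestrictNormalHom`** — the same inside `F′` with `s|_{F′} = absRestrictNormalHom F′ s`.
* §2 (N1b) **`natCast_mul_log_valuation_eq_two_mul`**, **`dvd_two_mul_log_valuation`** — for any number field `E`, `σ ∈ Aut(E/F)`, a finite
  place `w` with `σ • w = w`, and `dⁿ = b·σ(b)`, `b ≠ 0`: `n · ord_w(d) = 2 · ord_w(b)`, so `n ∣ 2·ord_w(b)` (tree: `Automorphic.GaloisActionPlaces`).
* §3 (N1c) **`absRestrictNormalHom_smul_eq_of_smul_eq`** — if `s ∈ Γ_K` stabilises a prime `𝔓` of `\bar ℤ_K` lying over the place `w″` of the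
  Galois subfield `F′ ⊆ K̄` (`𝔓 ∩ 𝓞 F′ = w″`), then `s|_{F′}` fixes `w″`; `…_of_mem_inertia` (inertia elements stabilise).
* §4 (N1d) **`dvd_two_mul_log_valuation_of_twisted`** — ASSEMBLY: for every place `w″` of `F′` below a prime `𝔓` whose decomposition group
  contains some `s ∈ U` with `ε(s) = −1` (all places above `S_{θ₀} ∖ {2-adic}`: there `I_𝔓 ≤ U` and `θ₀(I_𝔓) ≠ 1`; the non-split places
  above `v̄`), `n ∣ 2 · ord_{w″}(b)` — for `n = 2^{M+1}` this is R1's hypothesis `2^M ∣ ord_{w″}(b)`, obtained from the twisted cocycle ALONE;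
  **`…_of_mem_inertia`** — the `S_{θ₀}` form (`s ∈ U ∩ I_𝔓`, `ε s = −1`).
NOT here: the class-level adapter H¹(U, X) ↔ twisted cocycles (-w3 g13 p703858 `KummerUClassLevel`), B2d (-w8 g5), the `v̄` pairing reading
at the SPLIT places above `v̄` (B5-U, -w7 g6), the twisted (PRO-NULL)_U assembly (-w3 g13, «…_of_local_twisted»), which takes these
divisibilities as input at the non-split places.
presearch: «Kummer class minus part quadratic extension valuation non-split prime» → folklore (genus theory / ambiguous classes pattern;
NSW (1.6.x) inflation–restriction); [corpus: none states it in this form] (queries "twisted Kummer cocycle valuation", "minus part Kummer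
non-split"; corpus+galaxy not re-run — plumbing lemma); no new fact. beyond-print theorem: no.

References: [NeukirchSchmidtWingberg2008] (1.6.6)–(1.6.7); [SerreLocalFields1979] X §3 b); [CasselsFrohlich1967] Ch. VII §1.1;
[NeukirchANT1999] Ch. I §9 (9.1)–(9.4).
-/

noncomputable section

open scoped Classical Pointwise

set_option linter.dupNamespace false
set_option autoImplicit false

open NumberField IsDedekindDomain Field IntermediateField
open Literature.NumberTheory.EllipticCurves
open Literature.NumberTheory.GaloisRepresentations Literature.NumberTheory.GaloisRepresentations.LocalWeilDatum

namespace Summit.BirchSwinnertonDyer.BirchSwinnertonDyer.Theorems.PrintCf2.KummerUDict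

/-! ## §1. (N1) `b · s(b)` is an `n`-th power in `F′` when `ε s = −1` -/

section NonSplit

variable {K : Type} [Field K] (U : Subgroup (absoluteGaloisGroup K)) (ε : absoluteGaloisGroup K →* ℤˣ)

/-- **(N1) `b · s(b) = dⁿ` IN `F′` FOR `ε(s) = −1`.** Let `c` be an `ε`-twisted cocycle on `U` which on `Gal(K̄/F′) ≤ U` (`ε = 1` there, and
`Gal(K̄/F′) ⊇ {u ∈ U : ε u = 1}`) is the Kummer cocycle of `β`, `βⁿ = b ∈ F′`, and let `s ∈ U` with `ε s = −1`, `c(s)ⁿ = 1`. Then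
`δ := β · sβ · c(s)` is fixed by `Gal(K̄/F′)` (the twisted cocycle identity at `(s, s⁻¹us)` and at `(u, s)`), so `δ = d ∈ F′`, and
`dⁿ = b · s(b)`. (The class of `b` in `F′ˣ/F′ˣⁿ` lies in the `ε`-part: `s[b] = [b]⁻¹`.) [cite: NeukirchSchmidtWingberg2008, (1.6.6)–(1.6.7)]
[cite: SerreLocalFields1979, X §3 b)] -/
theorem exists_algebraMap_pow_eq_mul_smul [CharZero K] (F' : IntermediateField K (AlgebraicClosure K))
    (hU' : galFixing K F' ≤ U) (hεU' : ∀ u ∈ galFixing K F', ε u = 1) (hker : ∀ u ∈ U, ε u = 1 → u ∈ galFixing K F')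
    {c : absoluteGaloisGroup K → (AlgebraicClosure K)ˣ} (hcoc : ∀ g ∈ U, ∀ h ∈ U, c (g * h) = c g * (g • c h) ^ ((ε g : ℤˣ) : ℤ))
    {s : absoluteGaloisGroup K} (hs : s ∈ U) (hεs : ((ε s : ℤˣ) : ℤ) = -1) {n : ℕ} (hcs : c s ^ n = 1)
    {β : AlgebraicClosure K} (hβ : β ≠ 0) (hres : ∀ u ∈ galFixing K F', (c u : AlgebraicClosure K) = u • β / β)
    {b : F'} (hb : algebraMap F' (AlgebraicClosure K) b = β ^ n) :
    ∃ d : F', (algebraMap F' (AlgebraicClosure K) d) ^ n =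
      algebraMap F' (AlgebraicClosure K) b * s • algebraMap F' (AlgebraicClosure K) b := by
  set δ : AlgebraicClosure K := β * s • β * (c s : AlgebraicClosure K) with hδ
  have hsβ : s • β ≠ 0 := (smul_ne_zero_iff_ne _).mpr hβ
  have hfix : ∀ u : galFixing K F', (u : absoluteGaloisGroup K) • δ = δ := by
    rintro ⟨u, hu⟩
    have huU : u ∈ U := hU' hu
    -- `u′ = s⁻¹us ∈ Gal(K̄/F′)`
    have hu'U : s⁻¹ * u * s ∈ U := U.mul_mem (U.mul_mem (U.inv_mem hs) huU) hs
    have hεu' : ε (s⁻¹ * u * s) = 1 := by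
      rw [map_mul, map_mul, map_inv, hεU' u hu, mul_one, inv_mul_cancel]
    have hu' : s⁻¹ * u * s ∈ galFixing K F' := hker _ hu'U hεu'
    -- the two readings of `c(us) = c(s·u′)`
    have h1 := hcoc s hs (s⁻¹ * u * s) hu'U
    have h2 := hcoc u huU s hs
    rw [hεs, zpow_neg, zpow_one] at h1
    rw [hεU' u hu, Units.val_one, zpow_one] at h2
    have hsu : s * (s⁻¹ * u * s) = u * s := by group
    rw [hsu, h2] at h1
    -- h1 : c u * u • c s = c s * (s • c (s⁻¹us))⁻¹, in `K̄ˣ`; read in `K̄`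
    have h1' := congrArg (fun x : (AlgebraicClosure K)ˣ ↦ (x : AlgebraicClosure K) * (s • (c (s⁻¹ * u * s) : AlgebraicClosure K))) h1
    simp only [Units.val_mul, Units.coe_smul, Units.val_inv_eq_inv_val] at h1'
    rw [inv_mul_cancel_right₀ ((smul_ne_zero_iff_ne _).mpr (c (s⁻¹ * u * s)).ne_zero)] at h1'
    rw [hres u hu, hres _ hu', smul_div₀', smul_smul, hsu, mul_smul] at h1'
    -- h1' : u•β/β * u•c(s) * (u•s•β / s•β) = c s
    have husβ : u • s • β ≠ 0 := (smul_ne_zero_iff_ne _).mpr hsβ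
    change u • (β * s • β * (c s : AlgebraicClosure K)) = β * s • β * (c s : AlgebraicClosure K)
    rw [smul_mul', smul_mul']
    field_simp at h1'
    linear_combination h1'
  obtain ⟨d, hd⟩ := galFixing.exists_algebraMap_eq_of_forall_smul_eq F' hfix
  refine ⟨d, ?_⟩
  have hcsn : (c s : AlgebraicClosure K) ^ n = 1 := by rw [← Units.val_pow_eq_pow_val, hcs, Units.val_one]
  rw [hd, hδ, mul_pow, mul_pow, hcsn, mul_one, ← smul_pow', ← hb]

/-- **(N1′) the same inside `F′`** for `F′/K` normal: `dⁿ = b · (s|_{F′}) b` with `s|_{F′} = absRestrictNormalHom F′ s`.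
[cite: NeukirchSchmidtWingberg2008, (1.6.6)–(1.6.7)] -/
theorem exists_pow_eq_mul_absRestrictNormalHom [CharZero K] (F' : IntermediateField K (AlgebraicClosure K)) [Normal K F']
    (hU' : galFixing K F' ≤ U) (hεU' : ∀ u ∈ galFixing K F', ε u = 1) (hker : ∀ u ∈ U, ε u = 1 → u ∈ galFixing K F')
    {c : absoluteGaloisGroup K → (AlgebraicClosure K)ˣ} (hcoc : ∀ g ∈ U, ∀ h ∈ U, c (g * h) = c g * (g • c h) ^ ((ε g : ℤˣ) : ℤ))
    {s : absoluteGaloisGroup K} (hs : s ∈ U) (hεs : ((ε s : ℤˣ) : ℤ) = -1) {n : ℕ} (hcs : c s ^ n = 1)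
    {β : AlgebraicClosure K} (hβ : β ≠ 0) (hres : ∀ u ∈ galFixing K F', (c u : AlgebraicClosure K) = u • β / β)
    {b : F'} (hb : algebraMap F' (AlgebraicClosure K) b = β ^ n) :
    ∃ d : F', d ^ n = b * absRestrictNormalHom F' s b := by
  obtain ⟨d, hd⟩ := exists_algebraMap_pow_eq_mul_smul U ε F' hU' hεU' hker hcoc hs hεs hcs hβ hres hb
  refine ⟨d, (algebraMap F' (AlgebraicClosure K)).injective ?_⟩
  rw [map_pow, hd, map_mul]
  congr 1
  exact (AlgEquiv.restrictNormal_commutes (absoluteGaloisGroup.toAlgEquiv K s) F' b).symm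

end NonSplit

/-! ## §2. (N1b) Valuations at a place fixed by `σ`: `dⁿ = b · σb ⟹ n · ord d = 2 · ord b` -/

section Valuation

open Literature.NumberTheory.Automorphic

variable {F E : Type*} [Field F] [Field E] [NumberField E] [Algebra F E]

/-- **(N1b) `n · ord_w(d) = 2 · ord_w(b)` at a `σ`-fixed place.** For a number field `E`, `σ ∈ Aut(E/F)`, a finite place `w` with `σ • w = w`
and `dⁿ = b · σ(b)` with `b ≠ 0`: `v_w(σ b) = v_{σw}(σ b) = v_w(b)` (`HeightOneSpectrum.valuation_algEquiv_smul`), so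
`n · log v_w(d) = 2 · log v_w(b)`. [cite: CasselsFrohlich1967, Ch. VII §1.1] -/
theorem natCast_mul_log_valuation_eq_two_mul (σ : E ≃ₐ[F] E) (w : HeightOneSpectrum (𝓞 E)) (hw : σ • w = w)
    {b d : E} (hb : b ≠ 0) {n : ℕ} (h : d ^ n = b * σ b) :
    (n : ℤ) * WithZero.log (w.valuation E d) = 2 * WithZero.log (w.valuation E b) := by
  have hσb : w.valuation E (σ b) = w.valuation E b := by
    have h1 := Literature.NumberTheory.Automorphic.HeightOneSpectrum.valuation_algEquiv_smul (F := F) σ w b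
    rwa [hw] at h1
  have hvb : w.valuation E b ≠ 0 := (Valuation.ne_zero_iff _).mpr hb
  have hval := congrArg (w.valuation E) h
  rw [map_pow, map_mul, hσb] at hval
  have hlog := congrArg WithZero.log hval
  rw [WithZero.log_pow, WithZero.log_mul hvb hvb, nsmul_eq_mul] at hlog
  rw [hlog]
  ring

/-- **(N1b, divisibility form) `n ∣ 2 · ord_w(b)`** at a `σ`-fixed place when `b · σ(b)` is an `n`-th power — for `n = 2^{M+1}` this is
`2^M ∣ ord_w(b)`, the valuation hypothesis of R1 (`KummerProNull.exists_level_forall_exists_pow_eq_of_local`) at the places of `F′` not split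
over `F`, with NO local condition. [cite: CasselsFrohlich1967, Ch. VII §1.1] -/
theorem dvd_two_mul_log_valuation (σ : E ≃ₐ[F] E) (w : HeightOneSpectrum (𝓞 E)) (hw : σ • w = w)
    {b d : E} (hb : b ≠ 0) {n : ℕ} (h : d ^ n = b * σ b) :
    (n : ℤ) ∣ 2 * WithZero.log (w.valuation E b) :=
  ⟨WithZero.log (w.valuation E d), by rw [← natCast_mul_log_valuation_eq_two_mul σ w hw hb h]⟩

/-- `2^{M+1} ∣ 2·a ⟹ 2^M ∣ a` (the level bookkeeping for `n = 2^{M+1}`). [folklore] -/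
theorem pow_dvd_of_pow_succ_dvd_two_mul {M : ℕ} {a : ℤ} (h : ((2 ^ (M + 1) : ℕ) : ℤ) ∣ 2 * a) : ((2 ^ M : ℕ) : ℤ) ∣ a := by
  rw [Nat.cast_pow, Nat.cast_ofNat, pow_succ, mul_comm ((2 : ℤ) ^ M) 2] at h
  rw [Nat.cast_pow, Nat.cast_ofNat]
  exact (mul_dvd_mul_iff_left two_ne_zero).mp h

end Valuation

/-! ## §3. (N1c) An element stabilising a prime `𝔓 ∣ w″` of `\bar ℤ_K` fixes the place `w″` of the Galois subfield `F′` -/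

section FixedPlace

open Literature.NumberTheory.Automorphic

universe u

variable {K : Type u} [Field K] [NumberField K] (F' : IntermediateField K (AlgebraicClosure K)) [NumberField F'] [IsGalois K F']

omit [NumberField K] [NumberField F'] in
/-- **(N1c) `s • 𝔓 = 𝔓 ⟹ s|_{F′} • w″ = w″`** for a prime `𝔓` of `\bar ℤ_K` with `𝔓 ∩ 𝓞 F′ = 𝔭_{w″}`: the restriction
`Γ_K → Gal(F′/K)` intertwines the actions on `𝓞 F′ ⊆ \bar ℤ_K` (`ringOfIntegersToIntegralClosure_absRestrictNormalHom_smul`), so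
`s|_{F′} • 𝔭_{w″} = (s • 𝔓) ∩ 𝓞 F′ = 𝔭_{w″}`. [cite: NeukirchANT1999, Ch. I §9 (9.1)–(9.4)] -/
theorem absRestrictNormalHom_smul_eq_of_smul_eq (w : HeightOneSpectrum (𝓞 F')) (𝔓 : Ideal (absIntegers (𝓞 K) K))
    (h𝔓 : 𝔓.comap (ringOfIntegersToIntegralClosure (k := K) (Ω := AlgebraicClosure K) F') = w.asIdeal)
    {s : absoluteGaloisGroup K} (hs : s • 𝔓 = 𝔓) :
    absRestrictNormalHom F' s • w = w := by
  apply HeightOneSpectrum.ext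
  rw [Literature.NumberTheory.Automorphic.HeightOneSpectrum.smul_asIdeal, ← h𝔓]
  set j : 𝓞 F' →+* absIntegers (𝓞 K) K := ringOfIntegersToIntegralClosure (k := K) (Ω := AlgebraicClosure K) F' with hj
  have key : ∀ y : 𝓞 F', j (((absRestrictNormalHom F') s)⁻¹ • y) = s⁻¹ • j y := fun y ↦ by
    rw [← map_inv]
    exact ringOfIntegersToIntegralClosure_absRestrictNormalHom_smul F' s⁻¹ y
  ext x
  calc x ∈ absRestrictNormalHom F' s • Ideal.comap j 𝔓
        ↔ (absRestrictNormalHom F' s)⁻¹ • x ∈ Ideal.comap j 𝔓 := Ideal.mem_pointwise_smul_iff_inv_smul_mem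
    _ ↔ j ((absRestrictNormalHom F' s)⁻¹ • x) ∈ 𝔓 := Ideal.mem_comap
    _ ↔ s⁻¹ • j x ∈ 𝔓 := by rw [key]
    _ ↔ j x ∈ s • 𝔓 := Ideal.mem_pointwise_smul_iff_inv_smul_mem.symm
    _ ↔ j x ∈ 𝔓 := by rw [hs]
    _ ↔ x ∈ Ideal.comap j 𝔓 := Ideal.mem_comap.symm

/-- Inertia elements stabilise the prime: `s ∈ I_𝔓 ⟹ s • 𝔓 = 𝔓` (Mathlib `Ideal.inertia_le_stabilizer`). [cite: NeukirchANT1999, Ch. I §9 (9.4)] -/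
theorem smul_eq_of_mem_inertia {G B : Type*} [Group G] [CommRing B] [MulSemiringAction G B] (𝔓 : Ideal B) {s : G}
    (hs : s ∈ 𝔓.inertia G) : s • 𝔓 = 𝔓 :=
  MulAction.mem_stabilizer_iff.mp (Ideal.inertia_le_stabilizer 𝔓 hs)

omit [NumberField K] [NumberField F'] in
/-- **(N1c, inertia form)** `s ∈ I_𝔓 ⟹ s|_{F′} • w″ = w″`. [cite: NeukirchANT1999, Ch. I §9 (9.4)] -/
theorem absRestrictNormalHom_smul_eq_of_mem_inertia (w : HeightOneSpectrum (𝓞 F')) (𝔓 : Ideal (absIntegers (𝓞 K) K))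
    (h𝔓 : 𝔓.comap (ringOfIntegersToIntegralClosure (k := K) (Ω := AlgebraicClosure K) F') = w.asIdeal)
    {s : absoluteGaloisGroup K} (hs : s ∈ 𝔓.inertia (absoluteGaloisGroup K)) :
    absRestrictNormalHom F' s • w = w :=
  absRestrictNormalHom_smul_eq_of_smul_eq F' w 𝔓 h𝔓 (smul_eq_of_mem_inertia 𝔓 hs)

end FixedPlace

/-! ## §4. (N1d) Assembly: `n ∣ 2·ord_{w″}(b)` at every place of `F′` below a prime whose decomposition group meets `{ε = −1} ∩ U` -/

section Assembly

variable {K : Type} [Field K] [NumberField K] (U : Subgroup (absoluteGaloisGroup K)) (ε : absoluteGaloisGroup K →* ℤˣ)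
  (F' : IntermediateField K (AlgebraicClosure K)) [NumberField F'] [IsGalois K F']

/-- **(N1d) THE NON-SPLIT VALUATION TRICK, assembled.** Let `c` be an `ε`-twisted cocycle on `U` which is the Kummer cocycle of `β` on
`Gal(K̄/F′) = {u ∈ U : ε u = 1}`, `βⁿ = b ∈ F′`. For every place `w″` of `F′` and prime `𝔓` of `\bar ℤ_K` over it such that SOME `s ∈ U` with
`ε(s) = −1` stabilises `𝔓` (i.e. `w″` does not split over `F = K̄^U ∩ …`; `c(s)ⁿ = 1`), `n ∣ 2 · ord_{w″}(b)` — with NO local condition on `c`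
at `w″`. For `n = 2^{M+1}`: `2^M ∣ ord_{w″}(b)` (`pow_dvd_of_pow_succ_dvd_two_mul`), the R1 hypothesis at `w″`.
[cite: NeukirchSchmidtWingberg2008, (1.6.6)–(1.6.7)] [cite: CasselsFrohlich1967, Ch. VII §1.1] -/
theorem dvd_two_mul_log_valuation_of_twisted
    (hU' : galFixing K F' ≤ U) (hεU' : ∀ u ∈ galFixing K F', ε u = 1) (hker : ∀ u ∈ U, ε u = 1 → u ∈ galFixing K F')
    {c : absoluteGaloisGroup K → (AlgebraicClosure K)ˣ} (hcoc : ∀ g ∈ U, ∀ h ∈ U, c (g * h) = c g * (g • c h) ^ ((ε g : ℤˣ) : ℤ))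
    {n : ℕ} {β : AlgebraicClosure K} (hβ : β ≠ 0) (hres : ∀ u ∈ galFixing K F', (c u : AlgebraicClosure K) = u • β / β)
    {b : F'} (hb : algebraMap F' (AlgebraicClosure K) b = β ^ n)
    (w : HeightOneSpectrum (𝓞 F')) (𝔓 : Ideal (absIntegers (𝓞 K) K))
    (h𝔓 : 𝔓.comap (ringOfIntegersToIntegralClosure (k := K) (Ω := AlgebraicClosure K) F') = w.asIdeal)
    {s : absoluteGaloisGroup K} (hs : s ∈ U) (hεs : ((ε s : ℤˣ) : ℤ) = -1) (hcs : c s ^ n = 1) (hs𝔓 : s • 𝔓 = 𝔓) :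
    (n : ℤ) ∣ 2 * WithZero.log (w.valuation F' b) := by
  haveI : Normal K F' := inferInstance
  obtain ⟨d, hd⟩ := exists_pow_eq_mul_absRestrictNormalHom U ε F' hU' hεU' hker hcoc hs hεs hcs hβ hres hb
  have hb0 : b ≠ 0 := by
    rintro rfl
    rw [map_zero] at hb
    exact pow_ne_zero n hβ hb.symm
  exact dvd_two_mul_log_valuation (absRestrictNormalHom F' s) w (absRestrictNormalHom_smul_eq_of_smul_eq F' w 𝔓 h𝔓 hs𝔓) hb0 hd

/-- **(N1d, `S_{θ₀}` form)** the same with `s ∈ U ∩ I_𝔓`, `ε(s) = −1` — available at every place above a prime `w ∤ 2·v̄` of `K` at which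
`θ₀` RAMIFIES (`I_𝔓 ≤ U` because `K̄^U/K` is unramified at `w`). [cite: NeukirchSchmidtWingberg2008, (1.6.6)–(1.6.7)] -/
theorem dvd_two_mul_log_valuation_of_twisted_of_mem_inertia
    (hU' : galFixing K F' ≤ U) (hεU' : ∀ u ∈ galFixing K F', ε u = 1) (hker : ∀ u ∈ U, ε u = 1 → u ∈ galFixing K F')
    {c : absoluteGaloisGroup K → (AlgebraicClosure K)ˣ} (hcoc : ∀ g ∈ U, ∀ h ∈ U, c (g * h) = c g * (g • c h) ^ ((ε g : ℤˣ) : ℤ))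
    {n : ℕ} {β : AlgebraicClosure K} (hβ : β ≠ 0) (hres : ∀ u ∈ galFixing K F', (c u : AlgebraicClosure K) = u • β / β)
    {b : F'} (hb : algebraMap F' (AlgebraicClosure K) b = β ^ n)
    (w : HeightOneSpectrum (𝓞 F')) (𝔓 : Ideal (absIntegers (𝓞 K) K))
    (h𝔓 : 𝔓.comap (ringOfIntegersToIntegralClosure (k := K) (Ω := AlgebraicClosure K) F') = w.asIdeal)
    {s : absoluteGaloisGroup K} (hs : s ∈ U) (hεs : ((ε s : ℤˣ) : ℤ) = -1) (hcs : c s ^ n = 1)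
    (hsI : s ∈ 𝔓.inertia (absoluteGaloisGroup K)) :
    (n : ℤ) ∣ 2 * WithZero.log (w.valuation F' b) :=
  dvd_two_mul_log_valuation_of_twisted U ε F' hU' hεU' hker hcoc hβ hres hb w 𝔓 h𝔓 hs hεs hcs (smul_eq_of_mem_inertia 𝔓 hsI)

end Assembly

end Summit.BirchSwinnertonDyer.BirchSwinnertonDyer.Theorems.PrintCf2.KummerUDict

end
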